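import Literature.AlgebraicGeometry.Resolution.AlterationsSections
import Literature.AlgebraicGeometry.Resolution.AlterationsDimension
import Literature.AlgebraicGeometry.Resolution.FiniteBirationalNormal
import Literature.AlgebraicGeometry.Resolution.ResolutionOfCurves
import HarnessLib

/-!
# De Jong's alteration theorem: the strict transform 4.15 and the Galois normalisation 4.16

Topic: `Literature/AlgebraicGeometry/Resolution`. Companion to `AlterationsSections.lean`, which
vendors de Jong 1996, 4.15–4.16 — from a fibred pair `(X, Z)` with (vi) e) to fibred pairs with
(vi) e) and (vi) f) `Z = ⋃ σᵢ(Y)` (`DeJong1996.IsUnionOfSections`) — as ONE named fact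
`DeJong1996SectionsReduction`. The printed text:

> "4.15. Assume (i)–(v), (vi) a)–e). In the sequel we will consider projective alterations
> `ψ : Y' → Y`, which are generically étale. Consider the diagram
> `X' → Y' ×_Y X → X` over `Y' = Y' → Y`. Here `X'` is the reduction of the scheme `Y' ×_Y X`,
> i.e. `f'` is the strict transform of `f` with respect to the alteration `ψ`, cf. 2.20 and
> 2.18. Put `Z' = pr₂⁻¹(Z)_red` considered either as a closed subscheme of `Y' ×_Y X` or of
> `X'`. It is easy to see that the morphism `f'` satisfies (vi) a)–c); from this we conclude
> that `X'` is irreducible. Thus `φ : X' → X` is a projective alteration which is generically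
> étale. Conditions (i), (iii) and (iv) are all right for the pair `(X', Z')`, but (v) may
> fail, for example if `Y'` is not normal. Finally, (vi) d) is trivial to verify for `f'|_{Z'}`
> and (vi) e) holds since `φ⁻¹(sm(X/Y)) ⊂ sm(X'/Y')`. As before it is clear that it suffices
> to prove the theorem for the pair `(X', Z')`.
> 4.16. Assume (i)–(iv), (vi) a)–e). Let `Z = ⋃ᵢ₌₁ⁿ Zᵢ` be the decomposition into irreducible
> components of `Z`. Choose a finite separable Galois extension `k(Y) ⊂ L` such that `k(Zᵢ)`
> may be embedded over `k(Y)` into `L` for all `i`; this is possible as the field extensions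
> `k(Y) ⊂ k(Zᵢ)` are finite separable by (vi) d). Let `Y'` be the normalization of `Y` in the
> field `L`, then `ψ : Y' → Y` is a (finite) generically étale alteration of `Y`. Constructing
> `(X', Z')` as in 4.15, we see that `Z' = Z'₁ ∪ … ∪ Z'ₙ` with `Z'ᵢ → Y'` finite and
> birational. (Any component of `Z'` dominates `Y'` as `Z'` has pure codimension 1 in `X'` in
> view of (iv).) Thus `Z'ᵢ → Y'` is an isomorphism as `Y'` is normal. It follows that we may
> assume the following property in addition to (i)–(iv), (vi) a)–e):
> (vi) f) There are sections `σᵢ : Y → X`, `i = 1, …, n` of `f` such that `Z = ⋃ σᵢ(Y)`."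
> (p. 71)

Accordingly this file

* vendors **4.15** as a NAMED FACT `DeJong1996StrictTransform`, for an arbitrary generically
  étale alteration `ψ : Y' → Y` with `Y'` a projective variety (4.15 is invoked with the finite
  `ψ` of 4.16, the alteration of 4.17 and the modification of 4.22): the reduction `X'` of
  `Y' ×_Y X` — delivered through its characterisation, a surjective closed immersion
  `ι : X' → X ×_Y Y'` from a reduced scheme — with `f' = ι ≫ pr_{Y'}`, `φ = ι ≫ pr_X` and
  `Z' = φ⁻¹(Z)` is again a fibred pair with (vi) e), and `φ` is a generically étale
  alteration; PROVED corollary "it suffices to prove the theorem for the pair `(X', Z')`"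
  (`DeJong1996.ConclusionGenericallyEtale.of_strictTransform`, 4.4);
* vendors the construction of **4.16** as a NAMED FACT `DeJong1996GaloisNormalization`: there is
  a finite generically étale alteration `ψ : Y' → Y` from a NORMAL projective variety `Y'` such
  that every irreducible component of `Z' ⊆ X'` (for any `X'`, `ι` as in 4.15), with its
  reduced structure, maps finitely and birationally onto `Y'`;
* PROVES the rest of 4.16 (`DeJong1996.IsUnionOfSections.of_forall_maximal`): if every
  irreducible component of the closed `Z' ⊆ X'` is finite and birational over the normal
  variety `Y'`, then it is isomorphic to `Y'` ("Thus `Z'ᵢ → Y'` is an isomorphism as `Y'` is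
  normal", `isIso_of_isFinite_of_isBirational`) and the inverses are pairwise distinct sections
  `σᵢ` of `f'` with `Z' = ⋃ σᵢ(Y')`, i.e. (vi) f) (`DeJong1996.IsUnionOfSections f' Z'`); the
  components are the maximal members of a finite decomposition of `Z'` into irreducible closed
  subsets of the noetherian `X'`;
* PROVES the assembly `DeJong1996SectionsReduction.of_strictTransform_of_galoisNormalization`
  and its composite `DeJong1996MultisectionToPreSemiStablePair.of_strictTransform_of_galoisNormalization_of_toPre`;
  sanity: `DeJong1996StrictTransform` and `DeJong1996GaloisNormalization` are not consequences
  of Thm. 4.1 (they are constructions), so no `of_strongAlgClosed` direction is stated for them.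

`DeJong1996StrictTransform` is the node to PROVE next (base change of (vi) a)–c) along `ψ` and
reduction; irreducibility of `X'` from (vi) b), c); `φ` proper, surjective, finite over the
finite locus of `ψ`, étale over the étale locus; (iii) by the Segre embedding; (iv) by pulling
back the divisor, 4.10; (vi) d) for `Z'`; (vi) e) through the homeomorphic geometric fibres).
`DeJong1996GaloisNormalization` needs the function fields of the components of `Z`, a Galois
closure, the normalisation of `Y` in it (`NormalizationInExtension.lean`) and the generic fibre
of `Zᵢ ×_Y Y'`. The owning literature unit's `NOTES.md` keeps the DAG.

## Sources

* A. J. de Jong, *Smoothness, semi-stability and alterations*, Publ. Math. IHÉS 83 (1996) 51–93: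
  2.18, 2.20 (pp. 60–61), Thm. 4.1, 4.4, 4.5 (i) (pp. 66–67), 4.10 (p. 67), 4.15–4.16 (p. 71).
-/

noncomputable section

open CategoryTheory CategoryTheory.Limits AlgebraicGeometry TopologicalSpace Topology

namespace Literature.AlgebraicGeometry.Resolution

universe u

/-! ## 4.15 as a named fact -/

/-- NAMED FACT — **de Jong 1996, 4.15: the strict transform of a fibred pair along a generically
étale projective alteration of the base.** Over an algebraically closed field `k` ((i) of 4.5),
let `(X, Z)` with `f : X → Y → Spec k` satisfy (iii), (iv), (vi) a)–d)
(`DeJong1996.FibredPair f g Z`) and (vi) e) (`DeJong1996.HasThreeSmoothPoints f Z`), and let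
`ψ : Y' → Y` be a generically étale alteration (2.20, 2.6) with `Y'` a projective variety over
`k` ("projective alterations `ψ : Y' → Y`, which are generically étale"). "Here `X'` is the
reduction of the scheme `Y' ×_Y X` […]. Put `Z' = pr₂⁻¹(Z)_red` […]. It is easy to see that
the morphism `f'` satisfies (vi) a)–c); from this we conclude that `X'` is irreducible. Thus
`φ : X' → X` is a projective alteration which is generically étale. Conditions (i), (iii) and
(iv) are all right for the pair `(X', Z')`, but (v) may fail […]. Finally, (vi) d) is trivial
to verify for `f'|_{Z'}` and (vi) e) holds since `φ⁻¹(sm(X/Y)) ⊂ sm(X'/Y')`." Rendered: there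
are a scheme `X'` and a morphism `ι : X' → X ×_Y Y'` (Mathlib's `pullback f ψ`) which is a
closed immersion, surjective, with `X'` reduced — this characterises the reduction
`(X ×_Y Y')_red` up to unique isomorphism — such that, with `f' = ι ≫ pr_{Y'} : X' → Y'`
(locally of finite presentation), `φ = ι ≫ pr_X : X' → X` and `Z' = φ⁻¹(Z)`: `(X', Z')` with
`f' : X' → Y' → Spec k` is a fibred pair ((i) `X'` integral, (iii), (iv), (vi) a)–d)), (vi) e)
holds for it, and `φ` is a generically étale alteration. Users take
`(h : DeJong1996StrictTransform)`; it is a node to PROVE. [cite: DeJong1996, 4.15, p. 71] -/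
def DeJong1996StrictTransform : Prop :=
  ∀ (k : Type u) [Field k] [IsAlgClosed k] (X Y Y' : Scheme.{u}) [IsIntegral Y] [IsIntegral Y']
    (f : X ⟶ Y) [LocallyOfFinitePresentation f] (g : Y ⟶ Spec (.of k)) (Z : Set X)
    (ψ : Y' ⟶ Y),
    DeJong1996.FibredPair f g Z → DeJong1996.HasThreeSmoothPoints f Z →
      IsAlteration ψ → IsGenericallyEtale ψ →
        Literature.AlgebraicGeometry.Motives.IsProjectiveOver (Over.mk (ψ ≫ g)) →
          ∃ (X' : Scheme.{u}) (ι : X' ⟶ pullback f ψ) (_ : IsClosedImmersion ι)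
            (_ : Surjective ι) (_ : IsReduced X')
            (_ : LocallyOfFinitePresentation (ι ≫ pullback.snd f ψ)),
            DeJong1996.FibredPair (ι ≫ pullback.snd f ψ) (ψ ≫ g)
                ((ι ≫ pullback.fst f ψ) ⁻¹' Z) ∧
              DeJong1996.HasThreeSmoothPoints (ι ≫ pullback.snd f ψ)
                  ((ι ≫ pullback.fst f ψ) ⁻¹' Z) ∧
                IsAlteration (ι ≫ pullback.fst f ψ) ∧ IsGenericallyEtale (ι ≫ pullback.fst f ψ)

/-- **4.15, "As before it is clear that it suffices to prove the theorem for the pair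
`(X', Z')`"** (4.4 along the generically étale alteration `φ = ι ≫ pr_X`, whose structure
morphism to `Spec k` is `f' ≫ ψ ≫ g` since `pr_X ≫ f = pr_{Y'} ≫ ψ`) — PROVED for any `X'`
over `X ×_Y Y'`. [cite: DeJong1996, 4.15 and 4.4, pp. 66, 71] -/
theorem DeJong1996.ConclusionGenericallyEtale.of_strictTransform {k : Type u} [Field k]
    {X Y Y' X' : Scheme.{u}} [IsIntegral X] (f : X ⟶ Y) (g : Y ⟶ Spec (.of k)) (ψ : Y' ⟶ Y)
    (Z : Set X) (ι : X' ⟶ pullback f ψ) (hφ : IsAlteration (ι ≫ pullback.fst f ψ))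
    (hφet : IsGenericallyEtale (ι ≫ pullback.fst f ψ))
    (h : ConclusionGenericallyEtale ((ι ≫ pullback.snd f ψ) ≫ ψ ≫ g)
      ((ι ≫ pullback.fst f ψ) ⁻¹' Z)) :
    ConclusionGenericallyEtale (f ≫ g) Z := by
  refine ConclusionGenericallyEtale.of_isAlteration hφ hφet ?_
  have e : (ι ≫ pullback.fst f ψ) ≫ f ≫ g = (ι ≫ pullback.snd f ψ) ≫ ψ ≫ g := by
    simp only [Category.assoc]
    rw [pullback.condition_assoc]
  rw [e]
  exact h

/-! ## 4.16: sections from finite birational components over a normal base -/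

namespace DeJong1996.IsUnionOfSections

open Scheme.IdealSheafData

/-- **de Jong 1996, 4.16, "Thus `Z'ᵢ → Y'` is an isomorphism as `Y'` is normal. It follows that
[…] (vi) f) There are sections `σᵢ : Y → X`, `i = 1, …, n` of `f` such that `Z = ⋃ σᵢ(Y)`"
— PROVED.** Let `f' : X' → Y'` with `X'` a noetherian space and `Y'` an integral scheme all of
whose local rings are integrally closed, and let `Z' ⊆ X'` be closed. If every irreducible
component `C` of `Z'` (a maximal irreducible subset of `Z'`), with its reduced closed subscheme
structure, maps finitely and birationally to `Y'`, then `Z'` is a union of pairwise distinct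
sections of `f'` (`IsUnionOfSections f' Z'`): each `C → Y'` is an isomorphism
(`isIso_of_isFinite_of_isBirational`), its inverse followed by the inclusion is a section with
image `C`, and `Z'` is the finite union of its components (the maximal members of a finite
decomposition into irreducible closed subsets, `NoetherianSpace.exists_finite_set_isClosed_irreducible`).
[cite: DeJong1996, 4.16, p. 71] -/
theorem of_forall_maximal {X' Y' : Scheme.{u}} [IsIntegral Y'] [NoetherianSpace X']
    (f' : X' ⟶ Y') {Z' : Set X'} (hZ' : IsClosed Z')
    (hnorm : ∀ y' : Y', IsIntegrallyClosed (Y'.presheaf.stalk y'))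
    (hcomp : ∀ C : Set X', Maximal (fun s => IsIrreducible s ∧ s ⊆ Z') C →
      ∃ hC : IsClosed C,
        IsFinite ((vanishingIdeal ⟨C, hC⟩).subschemeι ≫ f') ∧
          IsBirational ((vanishingIdeal ⟨C, hC⟩).subschemeι ≫ f')) :
    IsUnionOfSections f' Z' := by
  classical
  -- a finite decomposition of the closed `Z'` into irreducible closed subsets
  obtain ⟨S, hSfin, hScl, hSirr, hSZ⟩ :=
    NoetherianSpace.exists_finite_set_isClosed_irreducible hZ'
  -- its maximal members are the irreducible components of `Z'`
  set M : Set (Set X') := {t | Maximal (· ∈ S) t} with hM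
  have hMfin : M.Finite := hSfin.subset fun t ht => ht.1
  have hmax : ∀ t ∈ M, Maximal (fun s => IsIrreducible s ∧ s ⊆ Z') t := by
    intro t ht
    refine ⟨⟨hSirr t ht.1, hSZ ▸ Set.subset_sUnion_of_mem ht.1⟩, ?_⟩
    rintro u ⟨hu, huZ⟩ htu
    -- the irreducible `u ⊆ ⋃₀ S`, a finite union of closed sets, lies in one member `t'`
    obtain ⟨t', ht'S, hut'⟩ := isIrreducible_iff_sUnion_isClosed.mp hu hSfin.toFinset
      (fun t ht => hScl t (hSfin.mem_toFinset.mp ht))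
      (by rw [hSfin.coe_toFinset, ← hSZ]; exact huZ)
    exact hut'.trans (ht.2 (hSfin.mem_toFinset.mp ht'S) (htu.trans hut'))
  have hcover : Z' = ⋃ t ∈ M, t := by
    apply le_antisymm
    · intro z hz
      rw [hSZ] at hz
      obtain ⟨t, htS, hzt⟩ := hz
      obtain ⟨t', htt', ht'⟩ := hSfin.exists_le_maximal htS
      exact Set.mem_biUnion ht' (htt' hzt)
    · intro z hz
      obtain ⟨t, ht, hzt⟩ := Set.mem_iUnion₂.mp hz
      exact (hmax t ht).1.2 hzt
  -- each component is isomorphic to `Y'`, whence a section with that image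
  have key : ∀ t : M, ∃ σ : Y' ⟶ X', σ ≫ f' = 𝟙 Y' ∧ Set.range σ = (t : Set X') := by
    rintro ⟨t, ht⟩
    obtain ⟨hC, hfin, hbir⟩ := hcomp t (hmax t ht)
    haveI : IsIntegral (vanishingIdeal (⟨t, hC⟩ : Closeds X')).subscheme :=
      isIntegral_subscheme_vanishingIdeal ⟨t, hC⟩ (hmax t ht).1.1
    haveI := hfin
    haveI : IsIso ((vanishingIdeal (⟨t, hC⟩ : Closeds X')).subschemeι ≫ f') :=
      isIso_of_isFinite_of_isBirational _ hnorm hbir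
    refine ⟨inv ((vanishingIdeal (⟨t, hC⟩ : Closeds X')).subschemeι ≫ f') ≫
      (vanishingIdeal (⟨t, hC⟩ : Closeds X')).subschemeι, by simp, ?_⟩
    have hr : Set.range (inv ((vanishingIdeal (⟨t, hC⟩ : Closeds X')).subschemeι ≫ f') ≫
        (vanishingIdeal (⟨t, hC⟩ : Closeds X')).subschemeι) =
        Set.range (vanishingIdeal (⟨t, hC⟩ : Closeds X')).subschemeι := by
      ext x
      constructor
      · rintro ⟨y, rfl⟩
        exact ⟨_, (Scheme.Hom.comp_apply _ _ y).symm⟩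
      · rintro ⟨c, rfl⟩
        refine ⟨((vanishingIdeal (⟨t, hC⟩ : Closeds X')).subschemeι ≫ f') c, ?_⟩
        rw [Scheme.Hom.comp_apply, ← Scheme.Hom.comp_apply _ (inv _), IsIso.hom_inv_id]
        rfl
    rw [hr, range_subschemeι_vanishingIdeal]
    rfl
  choose σ hσ hrange using key
  -- enumerate the finitely many components
  haveI : Finite M := hMfin.to_subtype
  obtain ⟨m, ⟨e⟩⟩ := Finite.exists_equiv_fin M
  refine ⟨m, fun i => σ (e.symm i), ?_, fun i => hσ _, ?_⟩
  · intro i j hij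
    have h1 : Set.range (σ (e.symm i)) = Set.range (σ (e.symm j)) := by
      simp only at hij
      rw [hij]
    rw [hrange, hrange] at h1
    exact e.symm.injective (Subtype.ext h1)
  · rw [hcover]
    ext z
    simp only [Set.mem_iUnion]
    constructor
    · rintro ⟨t, ht, hzt⟩
      refine ⟨e ⟨t, ht⟩, ?_⟩
      rw [Equiv.symm_apply_apply, hrange]
      exact hzt
    · rintro ⟨i, hz⟩
      rw [hrange] at hz
      exact ⟨_, (e.symm i).2, hz⟩

end DeJong1996.IsUnionOfSections

/-! ## 4.16 as a named fact -/

/-- NAMED FACT — **de Jong 1996, 4.16: a finite Galois normalisation of the base over which the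
components of `Z'` become birational to the base.** Over an algebraically closed field `k`, let
`(X, Z)` with `f : X → Y → Spec k` satisfy (iii), (iv), (vi) a)–d) (`DeJong1996.FibredPair f g Z`)
and (vi) e) (`DeJong1996.HasThreeSmoothPoints f Z`). "Let `Z = ⋃ᵢ₌₁ⁿ Zᵢ` be the decomposition
into irreducible components of `Z`. Choose a finite separable Galois extension `k(Y) ⊂ L` such
that `k(Zᵢ)` may be embedded over `k(Y)` into `L` for all `i`; this is possible as the field
extensions `k(Y) ⊂ k(Zᵢ)` are finite separable by (vi) d). Let `Y'` be the normalization of `Y`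
in the field `L`, then `ψ : Y' → Y` is a (finite) generically étale alteration of `Y`.
Constructing `(X', Z')` as in 4.15, we see that `Z' = Z'₁ ∪ … ∪ Z'ₙ` with `Z'ᵢ → Y'` finite and
birational. (Any component of `Z'` dominates `Y'` as `Z'` has pure codimension 1 in `X'` in
view of (iv).)" Rendered: there are an integral scheme `Y'`, projective over `k` (finite over
the projective `Y`) and normal ("the normalization of `Y` in the field `L`": all local rings
integrally closed), and a finite generically étale alteration `ψ : Y' → Y`, such that for every
`X'`, `ι : X' → X ×_Y Y'` as in 4.15 (`ι` a surjective closed immersion from a reduced scheme;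
`f' = ι ≫ pr_{Y'}`, `φ = ι ≫ pr_X`, `Z' = φ⁻¹(Z)`), every irreducible component `C` of `Z'` — a
maximal irreducible subset of `Z'`, automatically closed — with its reduced closed subscheme
structure maps to `Y'` by a finite birational morphism. The remaining sentence of 4.16 ("Thus
`Z'ᵢ → Y'` is an isomorphism as `Y'` is normal", whence (vi) f)) is PROVED in
`DeJong1996.IsUnionOfSections.of_forall_maximal`. Users take
`(h : DeJong1996GaloisNormalization)`; it is a node to prove (function fields of the `Zᵢ`, a
Galois closure, `normalizationIn`, the generic fibre of `Zᵢ ×_Y Y'`).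
[cite: DeJong1996, 4.16, p. 71] -/
def DeJong1996GaloisNormalization : Prop :=
  ∀ (k : Type u) [Field k] [IsAlgClosed k] (X Y : Scheme.{u}) [IsIntegral Y] (f : X ⟶ Y)
    [LocallyOfFinitePresentation f] (g : Y ⟶ Spec (.of k)) (Z : Set X),
    DeJong1996.FibredPair f g Z → DeJong1996.HasThreeSmoothPoints f Z →
      ∃ (Y' : Scheme.{u}) (_ : IsIntegral Y') (ψ : Y' ⟶ Y),
        IsFinite ψ ∧ IsAlteration ψ ∧ IsGenericallyEtale ψ ∧
          Literature.AlgebraicGeometry.Motives.IsProjectiveOver (Over.mk (ψ ≫ g)) ∧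
            (∀ y' : Y', IsIntegrallyClosed (Y'.presheaf.stalk y')) ∧
              ∀ (X' : Scheme.{u}) (ι : X' ⟶ pullback f ψ) [IsClosedImmersion ι] [Surjective ι]
                [IsReduced X'] (C : Set X'),
                Maximal (fun s => IsIrreducible s ∧ s ⊆ (ι ≫ pullback.fst f ψ) ⁻¹' Z) C →
                  ∃ hC : IsClosed C,
                    IsFinite ((Scheme.IdealSheafData.vanishingIdeal ⟨C, hC⟩).subschemeι ≫
                        ι ≫ pullback.snd f ψ) ∧
                      IsBirational ((Scheme.IdealSheafData.vanishingIdeal ⟨C, hC⟩).subschemeι ≫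
                        ι ≫ pullback.snd f ψ)

/-! ## The assembly -/

/-- **4.15–4.16 (`DeJong1996SectionsReduction`) from the strict transform 4.15
(`DeJong1996StrictTransform`), the Galois normalisation of 4.16 (`DeJong1996GaloisNormalization`)
and the PROVED end of 4.16 (`DeJong1996.IsUnionOfSections.of_forall_maximal`).** Given the
fibred pair `(X, Z)` with (vi) e): take `ψ : Y' → Y` from 4.16 and `(X', Z')`, `φ` from 4.15;
`X'` is noetherian (of finite type over `k`), so `Z'` is a union of pairwise distinct sections
of `f'`, i.e. `(X', Z')` is a fibred pair with (vi) e), f) of dimension `dim X'= dim X` (2.20,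
`IsAlteration.topologicalKrullDim_eq`); the hypothesis gives the conclusion of Thm. 4.1 for it,
and 4.4 along `φ` (`DeJong1996.ConclusionGenericallyEtale.of_strictTransform`) descends it to
`(X, Z)`. [cite: DeJong1996, 4.15–4.16, p. 71] -/
theorem DeJong1996SectionsReduction.of_strictTransform_of_galoisNormalization
    (h415 : DeJong1996StrictTransform.{u}) (h416 : DeJong1996GaloisNormalization.{u}) :
    DeJong1996SectionsReduction.{u} := by
  intro k _ _ X Y _ f _ g Z hP h3 hS
  obtain ⟨Y', hY', ψ, -, hψ, hψet, hproj, hnorm, hcomp⟩ := h416 k X Y f g Z hP h3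
  haveI := hY'
  obtain ⟨X', ι, hι, hsurj, hred, hlfp, hP', h3', hφ, hφet⟩ :=
    h415 k X Y Y' f g Z ψ hP h3 hψ hψet hproj
  haveI := hι
  haveI := hsurj
  haveI := hred
  haveI := hlfp
  haveI := hP.isIntegral
  -- `X'` is a noetherian space: it is of finite type over `k`
  haveI := hP'.locallyOfFiniteType
  haveI := hP'.quasiCompact
  haveI : IsLocallyNoetherian X' :=
    LocallyOfFiniteType.isLocallyNoetherian ((ι ≫ pullback.snd f ψ) ≫ ψ ≫ g)
  haveI : CompactSpace X' := QuasiCompact.compactSpace_of_compactSpace ((ι ≫ pullback.snd f ψ) ≫ ψ ≫ g)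
  haveI : IsNoetherian X' := {}
  -- (vi) f) for `(X', Z')`
  have hf' : DeJong1996.IsUnionOfSections (ι ≫ pullback.snd f ψ) ((ι ≫ pullback.fst f ψ) ⁻¹' Z) :=
    DeJong1996.IsUnionOfSections.of_forall_maximal _ hP'.isClosed hnorm (hcomp X' ι)
  have hdim : topologicalKrullDim X' = topologicalKrullDim X := by
    haveI := hP.locallyOfFiniteType
    exact hφ.topologicalKrullDim_eq (f ≫ g)
  exact DeJong1996.ConclusionGenericallyEtale.of_strictTransform f g ψ Z ι hφ hφet
    (hS X' Y' (ι ≫ pullback.snd f ψ) (ψ ≫ g) _ hP' h3' hf' hdim)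

/-- **4.15–4.22a (`DeJong1996MultisectionToPreSemiStablePair`) from 4.15, 4.16 and 4.17–4.22a
(`DeJong1996SectionsToPreSemiStablePair`).** [cite: DeJong1996, 4.15–4.22, pp. 71–74] -/
theorem DeJong1996MultisectionToPreSemiStablePair.of_strictTransform_of_galoisNormalization_of_toPre
    (h415 : DeJong1996StrictTransform.{u}) (h416 : DeJong1996GaloisNormalization.{u})
    (h₂ : DeJong1996SectionsToPreSemiStablePair.{u}) :
    DeJong1996MultisectionToPreSemiStablePair.{u} :=
  DeJong1996MultisectionToPreSemiStablePair.of_sections_of_toPre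
    (DeJong1996SectionsReduction.of_strictTransform_of_galoisNormalization h415 h416) h₂

end Literature.AlgebraicGeometry.Resolution

end
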